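import Literature.NumberTheory.EllipticCurves.BSDSelmerSmithDecomposition
import Literature.NumberTheory.EllipticCurves.ComplexMultiplicationTwistIsogenyProofs
import HarnessLib

/-!
# Smith's Case II in coefficients: `y² = x(x² + ax + b)` is in Case II iff `a² - 4b`, `b` and
# `b(a² - 4b)` are non-squares — and `X₀(49)` satisfies [Smi22a], Assumption 1.1 (2)

A `…Proofs` companion (theorems only; no definitions, no named facts) of `BSDSelmerSmithCases`
(Smith's Def. 1.6, `smithCaseII`), `BSDSelmerSmithAssumption` ([Smi22a], Assumption 1.1,
`smi22aAssumption`) and `BSDSelmerSmithCasesExplicitProofs` (whose §3 decides the cases only for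
models with *full* rational `2`-torsion, and whose Case II example `y² = x³ + 2x` uses the
special shape `a₂ = 0`).

* §1 For `E : y² = x(x² + ax + b)` over `ℚ` and `w ∈ ℚ̄` with `w² = a² - 4b`:
  `σ ∈ ker ρ̄_{E,2} ⟺ σ(w) = w` (`E[2] = {O, (0,0), ((-a ± w)/2, 0)}`), i.e. `ℚ(E[2]) = ℚ(√(a² - 4b))`
  (`mem_ker_galoisRepTorsion_two_iff_of_disc`).
* §2 **Smith, part II (J. Amer. Math. Soc. 39 (2026) 453–514), Example 1.2 made decidable**: with
  `A : y² = x(x² + ax + b)`, `A₀ : y² = x(x² - 2ax + (a² - 4b))` (the tree's `twoIsogenyCodomain`),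
  `K = ℚ(√(a² - 4b)) = ℚ(A[2])`, `K₀ = ℚ(√b) = ℚ(A₀[2])`, the standing hypothesis of [Smi22b] Thm. 1.4
  *"We assume `K` and `K₀` are distinct nontrivial extensions of `ℚ`"* is
  `¬ IsSquare (a² - 4b) ∧ ¬ IsSquare b ∧ ¬ IsSquare (b(a² - 4b))`, and this is EQUIVALENT to
  Smith's Case II (arXiv:2503.17619, Def. 1.6) for the model `⟨0, a, 0, b, 0⟩`
  (`smithCaseII_iff_not_isSquare`; `⟸` is `smithCaseII_of_not_isSquare`).
* §3 **`X₀(49)` (= `49a1` = the tree's `cm7 = ⟨1, -1, 0, -2, -1⟩`) is in Case II**, hence satisfies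
  [Smi22a], Assumption 1.1, branch (2): `(2, -8, 1, 0) • ⟨0, 21, 0, 112, 0⟩ = cm7`
  (`y² = x(x² + 21x + 112)`, `a² - 4b = -7`, `b = 112 = 4²·7`, `b(a² - 4b) = -28²`; so
  `ℚ(E[2]) = ℚ(√-7)`, `ℚ(E₀[2]) = ℚ(√7)`), `smithCaseII_cm7`, `smi22aAssumption_cm7`; and therefore
  **Smith's `1/2, 1/2, 0` law for the quadratic twists of `X₀(49)` follows from the REFEREED
  parts I–II alone** (`smith_selmerCorank_density_cm7_of_smith2022`: hypothesis
  `smith2022_selmerCorank_distribution` = [Smi22a] Thm. 1.2, whose branch (2) is proved in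
  [Smi22b] §1: "This proves the second case of [Smi1, Theorem 1.2]"), without the 2025 preprint
  arXiv:2503.17619 (needed only for Cases III–V). This is the "main hindrance" of
  Burungale–Castella–Skinner–Tian, Ann. Math. Québec 46 (2022), Rem. D ("`E(ℚ)[2] ≅ ℤ/2ℤ` for all
  elliptic curves `E/ℚ` with CM by `ℚ(√-7)`", so Smith's 2017 theorem did not apply) being lifted
  by [Smi22a]/[Smi22b]; used by the cell `bsd-goldfeld` (Goldfeld's conjecture for the twists of
  `X₀(49)` with good reduction at `2`, `Summits/BirchSwinnertonDyer/…/GoldfeldGoodTwists*.lean`).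

## References

* [Smith2022SelmerTwistI] A. Smith, *The distribution of `ℓ^∞`-Selmer groups in degree `ℓ` twist
  families I*, J. Amer. Math. Soc. 39 (2026), no. 1, 1–72 (arXiv:2207.05674): Assumption 1.1,
  Thm. 1.2, Rem. 1.6.
* [Smith2026SelmerTwistII] A. Smith, *… II*, J. Amer. Math. Soc. 39 (2026), no. 2, 453–514
  (arXiv:2207.05143): §1 Example 1.2, Prop. 1.3, Thm. 1.4 and the paragraph after it.
* [arXiv250317619] A. Smith, arXiv:2503.17619 (2025): Def. 1.6 (Case II), §1.1.
* [BurungaleCastellaSkinnerTian2022] Ann. Math. Québec 46 (2022) 325–346: Rem. D (p. 327).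
* [SilvermanAEC2009] J. H. Silverman, *AEC*, 2nd ed., III.1.4, III.3.1(b), III.4.5, X.4.9.
-/

noncomputable section

open scoped Classical

namespace Literature.NumberTheory.EllipticCurves

open WeierstrassCurve

/-! ## §1 `ℚ(E[2]) = ℚ(√(a² - 4b))` for `E : y² = x(x² + ax + b)` -/

/-- On `E : y² = x³ + ax² + bx` over `ℚ` with `w² = a² - 4b` in `ℚ̄`, `σ ∈ Γ_ℚ` fixes `E[2]`
pointwise iff `σ w = w`: `E[2] = {O, (0, 0), (r, 0), (s, 0)}` with `r, s = (-a ± w)/2`, so that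
`ℚ(E[2]) = ℚ(w)` (Silverman, *AEC*, III.§7 and VIII.1: `K(E[m])` is the field generated by the
coordinates of the `m`-torsion points; X.4.9: the model `y² = x³ + ax² + bx`).
[cite: SilvermanAEC2009, VIII.1 (Prop. 1.2 setting, `K(E[m])`) and X.4.9 (the model `y² = x³ + ax² + bx`)] -/
theorem mem_ker_galoisRepTorsion_two_iff_of_disc (E : WeierstrassCurve ℚ) [E.IsTwoTorsionNF]
    [E.IsElliptic] {w : AlgebraicClosure ℚ}
    (hw : w * w = algebraMap ℚ (AlgebraicClosure ℚ) (E.a₂ ^ 2 - 4 * E.a₄))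
    (σ : Field.absoluteGaloisGroup ℚ) :
    σ ∈ (E.galoisRepTorsion 2).ker ↔
      (show AlgebraicClosure ℚ ≃ₐ[ℚ] AlgebraicClosure ℚ from σ) w = w := by
  set ι := algebraMap ℚ (AlgebraicClosure ℚ) with hι
  set σ' : AlgebraicClosure ℚ ≃ₐ[ℚ] AlgebraicClosure ℚ := σ with hσ'
  have h2L : (2 : AlgebraicClosure ℚ) ≠ 0 := two_ne_zero
  set r : AlgebraicClosure ℚ := (-ι E.a₂ + w) / 2 with hr
  set s : AlgebraicClosure ℚ := (-ι E.a₂ - w) / 2 with hs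
  have hw' : w * w = ι E.a₂ ^ 2 - 4 * ι E.a₄ := by
    rw [hw]; simp [hι]
  have h₂ : (E.baseChange (AlgebraicClosure ℚ)).a₂ = -(r + s) := by
    rw [baseChange, map_a₂, hr, hs]; ring
  have h₄ : (E.baseChange (AlgebraicClosure ℚ)).a₄ = r * s := by
    rw [baseChange, map_a₄, hr, hs]
    linear_combination (1 / 4 : AlgebraicClosure ℚ) * hw'
  have hrroot : r ^ 3 + (E.baseChange (AlgebraicClosure ℚ)).a₂ * r ^ 2 +
      (E.baseChange (AlgebraicClosure ℚ)).a₄ * r = 0 := by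
    rw [h₂, h₄]; ring
  have hns := nonsingular_of_root (E.baseChange (AlgebraicClosure ℚ)) hrroot
  have hwr : w = 2 * r + ι E.a₂ := by rw [hr]; ring
  have hσr_iff : σ' r = r ↔ σ' w = w := by
    constructor
    · intro h
      rw [hwr, map_add, map_mul, map_ofNat, h, AlgEquiv.commutes]
    · intro h
      rw [hr, map_div₀, map_add, map_neg, AlgEquiv.commutes, h, map_ofNat]
  have hσs_of : σ' w = w → σ' s = s := by
    intro h
    rw [hs, map_div₀, map_sub, map_neg, AlgEquiv.commutes, h, map_ofNat]
  rw [mem_ker_galoisRepTorsion_iff']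
  constructor
  · intro h
    have hP2 : (2 : ℤ) • (Affine.Point.some r 0 hns : E.geomPoints) = 0 := by
      have h1 : (2 : ℕ) • (Affine.Point.some r 0 hns) = 0 :=
        (two_nsmul_some_eq_zero_iff (E.baseChange (AlgebraicClosure ℚ)) h2L hns).mpr rfl
      exact_mod_cast h1
    have hσP := h _ hP2
    obtain ⟨h', e'⟩ := smul_eq_some_of_eq' E σ
      (rfl : (Affine.Point.some r 0 hns : E.geomPoints) = _)
    rw [e'] at hσP
    exact hσr_iff.mp ((Affine.Point.some.injEq _ _ _ _ _ _).mp hσP).1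
  · intro hσw P hP
    have hP' : (2 : ℕ) • P = 0 := by exact_mod_cast hP
    rcases eq_of_two_nsmul_eq_zero (E.baseChange (AlgebraicClosure ℚ)) h2L h₂ h₄
      (P := P) hP' with h0 | ⟨x, hx, hPx, hx0⟩
    · have h0' : P = (0 : E.geomPoints) := h0
      rw [h0']
      exact smul_zero σ
    · obtain ⟨h', e'⟩ := smul_eq_some_of_eq' E σ hPx
      rw [e']
      have hσx : σ' x = x := by
        rcases hx0 with rfl | rfl | rfl
        · exact map_zero _
        · exact hσr_iff.mpr hσw
        · exact hσs_of hσw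
      obtain ⟨h'', e''⟩ := some_eq_some_of_eq (V := E.baseChange (AlgebraicClosure ℚ)) h' hσx
        (map_zero _)
      have hPx' : P = (Affine.Point.some x 0 h'' : E.geomPoints) := hPx
      rw [hPx']
      exact e''

/-! ## §2 Case II in coefficients ([Smi22b], Example 1.2: `K`, `K₀` distinct and nontrivial) -/

section Coefficients

variable (a b : ℚ)

/-- `Δ(y² = x³ + ax² + bx) = 16 b² (a² - 4b)` (from `b₂ = 4a`, `b₄ = 2b`, `b₆ = 0`, `b₈ = -b²`).
[cite: SilvermanAEC2009, III.1 (formulas for `b₂, b₄, b₆, b₈, Δ`) and X.4.9] -/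
theorem Δ_mk_twoTorsionNF :
    (⟨0, a, 0, b, 0⟩ : WeierstrassCurve ℚ).Δ = 16 * b ^ 2 * (a ^ 2 - 4 * b) := by
  simp only [WeierstrassCurve.Δ, WeierstrassCurve.b₂, WeierstrassCurve.b₄, WeierstrassCurve.b₆,
    WeierstrassCurve.b₈]
  ring

/-- `y² = x³ + ax² + bx` is elliptic iff `b ≠ 0` and `a² - 4b ≠ 0`; the "if" direction
(`Δ = 16 b²(a² - 4b)`). [cite: SilvermanAEC2009, III.1 (Δ ≠ 0 iff nonsingular, Prop. 1.4(a)) and X.4.9] -/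
theorem isElliptic_mk_of_ne (ha : a ^ 2 - 4 * b ≠ 0) (hb : b ≠ 0) :
    (⟨0, a, 0, b, 0⟩ : WeierstrassCurve ℚ).IsElliptic :=
  ⟨by
    rw [isUnit_iff_ne_zero, Δ_mk_twoTorsionNF]
    exact mul_ne_zero (mul_ne_zero (by norm_num) (pow_ne_zero 2 hb)) ha⟩

/-- For an elliptic `y² = x³ + ax² + bx`: `a² - 4b ≠ 0` and `b ≠ 0` (`Δ = 16 b²(a² - 4b) ≠ 0`).
[cite: SilvermanAEC2009, III.1 (Prop. 1.4(a)) and X.4.9] -/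
theorem ne_zero_of_isElliptic_mk [hE : (⟨0, a, 0, b, 0⟩ : WeierstrassCurve ℚ).IsElliptic] :
    a ^ 2 - 4 * b ≠ 0 ∧ b ≠ 0 := by
  have h := hE.isUnit.ne_zero
  rw [Δ_mk_twoTorsionNF] at h
  exact ⟨fun h0 ↦ h (by rw [h0, mul_zero]), fun h0 ↦ h (by rw [h0]; ring)⟩

/-- **Case II from the coefficients** ([Smi22b] = Smith, J. Amer. Math. Soc. 39 (2026) 453–514,
Example 1.2 with Thm. 1.4's standing hypothesis, in the language of arXiv:2503.17619, Def. 1.6):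
if `a² - 4b`, `b` and `b(a² - 4b)` are all non-squares in `ℚ`, then `E : y² = x(x² + ax + b)` is
in Case II — `E(ℚ)[2] = {O, (0,0)} ≅ ℤ/2ℤ` (`x² + ax + b` irreducible), the `2`-isogeny
`φ : E → E₀ : y² = x(x² - 2ax + (a² - 4b))` is not balanced
(`ℚ(E[2]) = ℚ(√(a² - 4b)) ≠ ℚ(√b) = ℚ(E₀[2])`: otherwise `√(a² - 4b)·√(16b)` would be
`Γ_ℚ`-fixed, i.e. `16 b (a² - 4b)` a rational square), and `E₀(ℚ)[2] ≇ (ℤ/2ℤ)²` (`b` is not a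
square). [cite: Smith2026SelmerTwistII, §1 Example 1.2 and Thm. 1.4]
[cite: arXiv250317619, Def. 1.6] -/
theorem smithCaseII_of_not_isSquare (h1 : ¬ IsSquare (a ^ 2 - 4 * b)) (h2 : ¬ IsSquare b)
    (h3 : ¬ IsSquare (b * (a ^ 2 - 4 * b))) :
    smithCaseII (⟨0, a, 0, b, 0⟩ : WeierstrassCurve ℚ) := by
  set E : WeierstrassCurve ℚ := ⟨0, a, 0, b, 0⟩ with hEdef
  have ha0 : a ^ 2 - 4 * b ≠ 0 := by
    intro h; exact h1 ⟨0, by rw [h, mul_zero]⟩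
  have hb0 : b ≠ 0 := by
    intro h; exact h2 ⟨0, by rw [h, mul_zero]⟩
  haveI : E.IsElliptic := isElliptic_mk_of_ne a b ha0 hb0
  have ha₂ : E.a₂ = a := rfl
  have ha₄ : E.a₄ = b := rfl
  have hdeg : (E.twoIsogeny).degree = 2 := degree_twoIsogeny _
  have hb₂ : E.twoIsogenyCodomain.a₂ = -2 * a := by rw [twoIsogenyCodomain_a₂, ha₂]
  have hb₄ : E.twoIsogenyCodomain.a₄ = a ^ 2 - 4 * b := by rw [twoIsogenyCodomain_a₄, ha₂, ha₄]
  refine ⟨?_, _, inferInstance, E.twoIsogeny, hdeg, ?_, ?_⟩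
  · -- `#E(ℚ)[2] = 2`
    rcases ratTwoTorsionCard_eq_one_or_two_or_four E with h | h | h4
    · exact absurd h (Isogeny.ratTwoTorsionCard_ne_one_of_degree_eq_two _ _ hdeg)
    · exact h
    · exfalso
      obtain ⟨α, β, hα, hβ⟩ := exists_roots_of_ker_galoisRepTorsion_two_eq_top _ two_ne_zero
        (ker_galoisRepTorsion_two_eq_top_of_ratTwoTorsionCard_eq_four _ h4)
      rw [ha₂] at hα
      rw [ha₄] at hβ
      exact h1 ⟨α - β, by rw [hα, hβ]; ring⟩
  · -- `φ` is not balanced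
    intro hbal
    obtain ⟨w, hw⟩ := IsAlgClosed.exists_eq_mul_self ((a ^ 2 - 4 * b : ℚ) : AlgebraicClosure ℚ)
    obtain ⟨u, hu⟩ := IsAlgClosed.exists_eq_mul_self ((16 * b : ℚ) : AlgebraicClosure ℚ)
    have hw0 : w ≠ 0 := by
      rintro rfl
      rw [mul_zero] at hw
      exact ha0 (by exact_mod_cast hw)
    have hE : ∀ σ : Field.absoluteGaloisGroup ℚ, σ ∈ (E.galoisRepTorsion 2).ker ↔
        (show AlgebraicClosure ℚ ≃ₐ[ℚ] AlgebraicClosure ℚ from σ) w = w :=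
      mem_ker_galoisRepTorsion_two_iff_of_disc E (by rw [ha₂, ha₄, eq_ratCast]; exact hw.symm)
    have hE₀ : ∀ σ : Field.absoluteGaloisGroup ℚ,
        σ ∈ (E.twoIsogenyCodomain.galoisRepTorsion 2).ker ↔
          (show AlgebraicClosure ℚ ≃ₐ[ℚ] AlgebraicClosure ℚ from σ) u = u :=
      mem_ker_galoisRepTorsion_two_iff_of_disc E.twoIsogenyCodomain (by
        rw [hb₂, hb₄, eq_ratCast, ← hu]; congr 1; ring)
    -- `wu` is fixed by `Γ_ℚ`
    have hfix : ∀ σ : Field.absoluteGaloisGroup ℚ,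
        (show AlgebraicClosure ℚ ≃ₐ[ℚ] AlgebraicClosure ℚ from σ) (w * u) = w * u := by
      intro σ
      have hiff : (show AlgebraicClosure ℚ ≃ₐ[ℚ] AlgebraicClosure ℚ from σ) w = w ↔
          (show AlgebraicClosure ℚ ≃ₐ[ℚ] AlgebraicClosure ℚ from σ) u = u := by
        rw [← hE, ← hE₀, hbal.2]
      have hσw : (show AlgebraicClosure ℚ ≃ₐ[ℚ] AlgebraicClosure ℚ from σ) w *
          (show AlgebraicClosure ℚ ≃ₐ[ℚ] AlgebraicClosure ℚ from σ) w = w * w := by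
        rw [← map_mul, ← hw, map_ratCast]
      have hσu : (show AlgebraicClosure ℚ ≃ₐ[ℚ] AlgebraicClosure ℚ from σ) u *
          (show AlgebraicClosure ℚ ≃ₐ[ℚ] AlgebraicClosure ℚ from σ) u = u * u := by
        rw [← map_mul, ← hu, map_ratCast]
      rw [map_mul]
      rcases mul_self_eq_mul_self_iff.mp hσw with h | h
      · rw [h, hiff.mp h]
      · rcases mul_self_eq_mul_self_iff.mp hσu with h' | h'
        · have hww : w = -w := (hiff.mpr h').symm.trans h
          have h2w : (2 : AlgebraicClosure ℚ) * w = 0 := by linear_combination hww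
          exact absurd ((mul_eq_zero.mp h2w).resolve_left two_ne_zero) hw0
        · rw [h, h']; ring
    -- hence `wu ∈ ℚ`, with square `16 b (a² - 4b)`
    haveI : IsGalois ℚ (AlgebraicClosure ℚ) :=
      @IsAlgClosure.isGalois ℚ (AlgebraicClosure ℚ) _ _ (AlgebraicClosure.instAlgebra ℚ) _ _
    obtain ⟨q, hq⟩ := (InfiniteGalois.mem_range_algebraMap_iff_fixed (w * u)).mpr hfix
    rw [eq_ratCast] at hq
    push_cast at hw hu
    have hq2 : ((q ^ 2 : ℚ) : AlgebraicClosure ℚ) =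
        ((16 * b * (a ^ 2 - 4 * b) : ℚ) : AlgebraicClosure ℚ) := by
      push_cast
      rw [hq]
      linear_combination (-(u * u)) * hw +
        (-((a : AlgebraicClosure ℚ) ^ 2 - 4 * (b : AlgebraicClosure ℚ))) * hu
    have hq2' : q ^ 2 = 16 * b * (a ^ 2 - 4 * b) := by exact_mod_cast hq2
    exact h3 ⟨q / 4, by linear_combination (-(1 : ℚ) / 16) * hq2'⟩
  · -- `#E₀(ℚ)[2] ≠ 4`
    intro h4
    obtain ⟨α, β, hα, hβ⟩ := exists_roots_of_ker_galoisRepTorsion_two_eq_top _ two_ne_zero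
      (ker_galoisRepTorsion_two_eq_top_of_ratTwoTorsionCard_eq_four _ h4)
    rw [hb₂] at hα
    rw [hb₄] at hβ
    exact h2 ⟨(α - β) / 4, by linear_combination (-(α + β) / 16 - a / 8) * hα + (-(1 : ℚ) / 4) * hβ⟩

/-- **Conversely, Case II forces the three non-square conditions** (for an elliptic
`E : y² = x(x² + ax + b)`): `#E(ℚ)[2] = 2` makes `x² + ax + b` irreducible (`a² - 4b ∉ ℚ²`); by
`forall_of_smithCaseII` the `2`-isogeny `E → E₀ : y² = x(x² - 2ax + (a² - 4b))` has
`ℚ(E₀[2]) ≠ ℚ` (`16b ∉ ℚ²`) and `ℚ(E₀[2]) ≠ ℚ(E[2])` (`√(a² - 4b)·√(16b) ∉ ℚ`, i.e.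
`b(a² - 4b) ∉ ℚ²`). [cite: Smith2026SelmerTwistII, §1 Example 1.2 and Thm. 1.4]
[cite: arXiv250317619, Def. 1.6] -/
theorem not_isSquare_of_smithCaseII [hEll : (⟨0, a, 0, b, 0⟩ : WeierstrassCurve ℚ).IsElliptic]
    (h : smithCaseII (⟨0, a, 0, b, 0⟩ : WeierstrassCurve ℚ)) :
    ¬ IsSquare (a ^ 2 - 4 * b) ∧ ¬ IsSquare b ∧ ¬ IsSquare (b * (a ^ 2 - 4 * b)) := by
  set E : WeierstrassCurve ℚ := ⟨0, a, 0, b, 0⟩ with hEdef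
  obtain ⟨ha0, hb0⟩ := ne_zero_of_isElliptic_mk a b
  have ha₂ : E.a₂ = a := rfl
  have ha₄ : E.a₄ = b := rfl
  have hdeg : (E.twoIsogeny).degree = 2 := degree_twoIsogeny _
  have hb₂ : E.twoIsogenyCodomain.a₂ = -2 * a := by rw [twoIsogenyCodomain_a₂, ha₂]
  have hb₄ : E.twoIsogenyCodomain.a₄ = a ^ 2 - 4 * b := by rw [twoIsogenyCodomain_a₄, ha₂, ha₄]
  have hII := forall_of_smithCaseII E h E.twoIsogenyCodomain E.twoIsogeny hdeg
  refine ⟨?_, ?_, ?_⟩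
  · rintro ⟨c, hc⟩
    have htop : (E.galoisRepTorsion 2).ker = ⊤ :=
      ker_galoisRepTorsion_two_eq_top_of_roots E two_ne_zero (r := (-a + c) / 2) (s := (-a - c) / 2)
        (by rw [ha₂]; ring) (by rw [ha₄]; linear_combination (-(1 : ℚ) / 4) * hc)
    have h4 := ratTwoTorsionCard_eq_four_of_ker_eq_top E htop
    rw [h.1] at h4
    exact absurd h4 (by decide)
  · rintro ⟨c, hc⟩
    exact hII.1 (ker_galoisRepTorsion_two_eq_top_of_roots E.twoIsogenyCodomain two_ne_zero
      (r := a + 2 * c) (s := a - 2 * c) (by rw [hb₂]; ring) (by rw [hb₄, hc]; ring))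
  · rintro ⟨q, hq⟩
    obtain ⟨w, hw⟩ := IsAlgClosed.exists_eq_mul_self ((a ^ 2 - 4 * b : ℚ) : AlgebraicClosure ℚ)
    obtain ⟨u, hu⟩ := IsAlgClosed.exists_eq_mul_self ((16 * b : ℚ) : AlgebraicClosure ℚ)
    have hw0 : w ≠ 0 := by
      rintro rfl
      rw [mul_zero] at hw
      exact ha0 (by exact_mod_cast hw)
    have hu0 : u ≠ 0 := by
      rintro rfl
      rw [mul_zero] at hu
      have h16 : (16 * b : ℚ) = 0 := by exact_mod_cast hu
      exact hb0 (by linear_combination (1 / 16 : ℚ) * h16)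
    have hE : ∀ σ : Field.absoluteGaloisGroup ℚ, σ ∈ (E.galoisRepTorsion 2).ker ↔
        (show AlgebraicClosure ℚ ≃ₐ[ℚ] AlgebraicClosure ℚ from σ) w = w :=
      mem_ker_galoisRepTorsion_two_iff_of_disc E (by rw [ha₂, ha₄, eq_ratCast]; exact hw.symm)
    have hE₀ : ∀ σ : Field.absoluteGaloisGroup ℚ,
        σ ∈ (E.twoIsogenyCodomain.galoisRepTorsion 2).ker ↔
          (show AlgebraicClosure ℚ ≃ₐ[ℚ] AlgebraicClosure ℚ from σ) u = u :=
      mem_ker_galoisRepTorsion_two_iff_of_disc E.twoIsogenyCodomain (by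
        rw [hb₂, hb₄, eq_ratCast, ← hu]; congr 1; ring)
    -- `(wu)² = (4q)²`, so `wu = ±4q ∈ ℚ` is `Γ_ℚ`-fixed
    have hq' : ((b * (a ^ 2 - 4 * b) : ℚ) : AlgebraicClosure ℚ) =
        ((q * q : ℚ) : AlgebraicClosure ℚ) := by rw [hq]
    have hsq : w * u * (w * u) =
        ((4 * q : ℚ) : AlgebraicClosure ℚ) * ((4 * q : ℚ) : AlgebraicClosure ℚ) := by
      rw [show w * u * (w * u) = w * w * (u * u) by ring, ← hw, ← hu]
      push_cast at hq' ⊢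
      linear_combination (16 : AlgebraicClosure ℚ) * hq'
    have hfix : ∀ σ : Field.absoluteGaloisGroup ℚ,
        (show AlgebraicClosure ℚ ≃ₐ[ℚ] AlgebraicClosure ℚ from σ) (w * u) = w * u := by
      intro σ
      rcases mul_self_eq_mul_self_iff.mp hsq with h' | h'
      · rw [h', map_ratCast]
      · rw [h', map_neg, map_ratCast]
    apply hII.2
    ext σ
    rw [hE₀ σ, hE σ]
    have hprod := hfix σ
    rw [map_mul] at hprod
    constructor
    · intro hσ
      rw [hσ] at hprod
      exact mul_right_cancel₀ hu0 hprod
    · intro hσ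
      rw [hσ] at hprod
      exact mul_left_cancel₀ hw0 hprod

/-- **Smith's Case II for `y² = x(x² + ax + b)` ⟺ `a² - 4b`, `b`, `b(a² - 4b)` are non-squares**
(`ℚ(√(a² - 4b))`, `ℚ(√b)` distinct nontrivial quadratic fields — the hypothesis of [Smi22b],
Thm. 1.4 / Example 1.2). [cite: Smith2026SelmerTwistII, §1 Example 1.2 and Thm. 1.4]
[cite: arXiv250317619, Def. 1.6] -/
theorem smithCaseII_iff_not_isSquare [(⟨0, a, 0, b, 0⟩ : WeierstrassCurve ℚ).IsElliptic] :
    smithCaseII (⟨0, a, 0, b, 0⟩ : WeierstrassCurve ℚ) ↔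
      ¬ IsSquare (a ^ 2 - 4 * b) ∧ ¬ IsSquare b ∧ ¬ IsSquare (b * (a ^ 2 - 4 * b)) :=
  ⟨not_isSquare_of_smithCaseII a b, fun h ↦ smithCaseII_of_not_isSquare a b h.1 h.2.1 h.2.2⟩

/-- Under the three non-square conditions `y² = x(x² + ax + b)` satisfies [Smi22a],
Assumption 1.1 (branch (2)). [cite: Smith2022SelmerTwistI, Assumption 1.1]
[cite: Smith2026SelmerTwistII, §1 Example 1.2 and Thm. 1.4] -/
theorem smi22aAssumption_of_not_isSquare (h1 : ¬ IsSquare (a ^ 2 - 4 * b)) (h2 : ¬ IsSquare b)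
    (h3 : ¬ IsSquare (b * (a ^ 2 - 4 * b))) :
    smi22aAssumption (⟨0, a, 0, b, 0⟩ : WeierstrassCurve ℚ) := by
  have ha0 : a ^ 2 - 4 * b ≠ 0 := by
    intro h; exact h1 ⟨0, by rw [h, mul_zero]⟩
  have hb0 : b ≠ 0 := by
    intro h; exact h2 ⟨0, by rw [h, mul_zero]⟩
  haveI := isElliptic_mk_of_ne a b ha0 hb0
  exact smi22aAssumption_of_smithCaseII _ (smithCaseII_of_not_isSquare a b h1 h2 h3)

end Coefficients

/-! ## §3 `X₀(49)` is in Case II: Smith's law for its twists from the refereed parts I–II -/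

section X049

/-- **The two-torsion normal form of `X₀(49) = 49a1`**: the change of variables
`(u, r, s, t) = (2, -8, 1, 0)` carries `y² = x(x² + 21x + 112)` to the reduced minimal model
`cm7 = [1, -1, 0, -2, -1]` (`x = 4x' - 8`, `y = 8y' + 4x'`; the rational `2`-torsion point
`(2, -1)` of `49a1` goes to `(0, 0)`).
[cite: SilvermanAEC2009, III.1 (Table 3.1, change-of-variables formulas for `a₁,…,a₆`)]
[cite: SilvermanATAEC1994, App. A §3 (second table, row D = -7: the model `[1, -1, 0, -2, -1]`)] -/
theorem smul_twoTorsionNF_eq_cm7 :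
    (⟨Units.mk0 (2 : ℚ) two_ne_zero, -8, 1, 0⟩ : VariableChange ℚ) •
        (⟨0, 21, 0, 112, 0⟩ : WeierstrassCurve ℚ) = cm7 := by
  simp only [variableChange_def]
  ext <;> norm_num

/-- `y² = x(x² + 21x + 112)` (a model of `X₀(49)`) is in Smith's Case II: `a² - 4b = -7`,
`b = 112 = 4²·7`, `b(a² - 4b) = -784 = -28²` are non-squares, i.e. `ℚ(E[2]) = ℚ(√-7)` and
`ℚ(E₀[2]) = ℚ(√7)` are distinct quadratic fields (Burungale–Castella–Skinner–Tian 2022, Rem. D: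
"`E(ℚ)[2] ≅ ℤ/2ℤ` for all elliptic curves `E/ℚ` with CM by `ℚ(√-7)`").
[cite: arXiv250317619, Def. 1.6] [cite: BurungaleCastellaSkinnerTian2022, Rem. D (p. 327)] -/
theorem smithCaseII_twoTorsionNF_cm7 : smithCaseII (⟨0, 21, 0, 112, 0⟩ : WeierstrassCurve ℚ) := by
  refine smithCaseII_of_not_isSquare 21 112 ?_ ?_ ?_
  · rintro ⟨c, hc⟩
    nlinarith [mul_self_nonneg c]
  · rintro ⟨c, hc⟩
    have h7 : IsSquare (7 : ℚ) := ⟨c / 4, by linear_combination (1 / 16 : ℚ) * hc⟩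
    norm_num at h7
  · rintro ⟨c, hc⟩
    nlinarith [mul_self_nonneg c]

/-- **`X₀(49)` (`cm7 = 49a1`) is in Case II of Smith, arXiv:2503.17619, Def. 1.6** (Case II is a
property of the curve: transported from the two-torsion normal form along the change of model
`smul_twoTorsionNF_eq_cm7`). [cite: arXiv250317619, Def. 1.6] -/
theorem smithCaseII_cm7 : smithCaseII cm7 := by
  obtain ⟨h2, W₀, hW₀, φ, hφ, hnb, hc⟩ := smithCaseII_twoTorsionNF_cm7
  obtain ⟨φ', hφ'⟩ := Isogeny.exists_comp_toIsogeny φ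
    (⟨Units.mk0 (2 : ℚ) two_ne_zero, -8, 1, 0⟩ : VariableChange ℚ)
  rw [← smul_twoTorsionNF_eq_cm7]
  refine ⟨(ratTwoTorsionCard_smul _ _).trans h2, W₀, hW₀, φ',
    (Isogeny.degree_eq_of_comp_toIsogeny hφ').trans hφ, fun hb' ↦ ?_, hc⟩
  exact hnb ⟨hφ, (ker_galoisRepTorsion_smul _ _ 2).symm.trans hb'.2⟩

/-- **`X₀(49)` satisfies [Smi22a], Assumption 1.1** (branch (2): `E(ℚ)[2] ≅ ℤ/2ℤ`,
`ℚ(E₀[2]) = ℚ(√7) ≠ ℚ`, `≠ ℚ(E[2]) = ℚ(√-7)`). [cite: Smith2022SelmerTwistI, Assumption 1.1]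
[cite: Smith2026SelmerTwistII, §1 Example 1.2] -/
theorem smi22aAssumption_cm7 : smi22aAssumption cm7 :=
  smi22aAssumption_of_smithCaseII cm7 smithCaseII_cm7

/-- **Smith's `2^∞`-Selmer corank law for the quadratic twists of `X₀(49)` from the refereed
parts I–II** (J. Amer. Math. Soc. 39 (2026), 1–72 and 453–514): among the twists `E^d` of
`E = X₀(49)` (`d` squarefree, by `|d|`) the `2^∞`-Selmer corank is `0`, `1`, `≥ 2` for densities
`1/2`, `1/2`, `0` — i.e. the tree's `smith_selmerCorank_density cm7` — from [Smi22a], Thm. 1.2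
alone (`smith2022_selmerCorank_distribution`; its branch (2), the one met by `X₀(49)`, is proved
in [Smi22b] §1: "This proves the second case of [Smi1, Theorem 1.2]"), with no appeal to the
preprint arXiv:2503.17619, to Modularity or to Monsky. Discharges the hypothesis `hS` of
`Summit.….GoldfeldGoodTwists.bsdRank_densityOne_twists_of_X049` from refereed print.
[cite: Smith2022SelmerTwistI, Thm. 1.2 with Assumption 1.1 (2)]
[cite: Smith2026SelmerTwistII, §1 Example 1.2, Thm. 1.4 and the paragraph after it] -/
theorem smith_selmerCorank_density_cm7_of_smith2022 (h22 : smith2022_selmerCorank_distribution) :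
    smith_selmerCorank_density cm7 :=
  smith_selmerCorank_density_of_smi22a_printed (fun A _ hA ↦ h22 A hA) cm7 smi22aAssumption_cm7

end X049

end Literature.NumberTheory.EllipticCurves

end
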